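/-
Copyright: lit-balaban Phase-2 proof seat p27 (gen 34).  Statement-level skeleton of a published paper; no proof claims beyond what the
kernel checks below.
-/
import Literature.MathematicalPhysics.QuantumFieldTheory.Balaban1983to89.B3Ineq210ZeroBox
import Literature.MathematicalPhysics.QuantumFieldTheory.BalabanImbrieJaffe1984to88.BIJ85AgmonDefect

/-!
# [BalabanImbrieJaffe1988] (2.30) p. 263 / [BalabanImbrieJaffe1985] §7.3 p. 326 — **THE FREE MASSIVE NEUMANN RESOLVENT
# `R_□ = (n²(−Δ^N_□) + m²)⁻¹` ON [6]'s BOX `□ = Π_i[0, nM_i)` AND ITS TILTED ROW BOUND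
# `Σ_{y∈□} e^{2t|x−y|_∞/n}R_□(x,y)² ≤ C₀·n^{−D}`** (`n = L^k`, `D = d + 1 ≤ 3`, `k`-uniform): the `ℓ² → ℓ^∞` smoothing input of the
# `k`-uniform SUP-NORM (operator-form) decay of the cube Neumann propagators `G_k(□,u)` at non-flat small fields (sibling file
# `BIJ88NeumannPropagatorSmallFieldSupDecay`), kernel file 1 of 2: minimum principle, positivity, comparison, free Agmon bound,
# resolvent identity, tilted block bound, and the tilted rows of [6]'s zero-field box Green's function (from the B3 (2.6)/(2.10) box
# pieces) and of `R_□`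

T. Bałaban, J. Imbrie, A. Jaffe, *Effective action and cluster properties of the abelian Higgs model*, Commun. Math. Phys. **114** (1988)
257–315 [BalabanImbrieJaffe1988], Sect. 2 p. 262–263 [PDF 6–7], (2.27)/(2.30); [I] = T. Bałaban, J. Imbrie, A. Jaffe, *Renormalization of
the Higgs model: minimizers, propagators and the stability of mean field theory*, Commun. Math. Phys. **97** (1985) 299–329
[BalabanImbrieJaffe1985], §7.3 p. 326 [PDF 28]; [6] = [7] of [I] = T. Bałaban, *Regularity and decay of lattice Green's functions*, Commun.
Math. Phys. **89** (1983) 571–597 [Balaban1983RegularityDecay], (1.6) p. 572, (1.10) p. 573, (2.44) p. 584; [B3] = T. Bałaban, *(Higgs)₂,₃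
quantum fields in a finite volume. III. Renormalization*, Commun. Math. Phys. **88** (1983) 411–445 [Balaban1983Higgs3], (2.6) p. 424,
(2.10) p. 426.

statement-level skeleton of published theorems with citation tags; proofs where landed; nothing here is a claim about the Yang–Mills mass gap

PDF held: `paper:balaban1988-cmp114-bij-abelian-higgs-effective-action` (journal page = PDF page + 256), p. 262–263 [PDF 6–7];
`paper:balaban1985-cmp97-bij-higgs-minimizers` (journal page = PDF page + 298), p. 326 [PDF 28]; [6] and [B3] as transcribed in the tree's
`Balaban1983to89.B4BoxCov237` / `B4Thm110ZeroBox` / `B3Ineq210ZeroBox` (box operator (2.44) in lattice units; the scale pieces (2.6) and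
their bounds (2.10) for the zero-field box).

CITATION HEADER (lean-in-tree rule).  Part of the lit-balaban TYPED SKELETON (HOME `run/shared/lean/pub/lit-balaban/`), PHASE-2 proof seat
p27 gen 34 (unit `lit-balaban-p27-g34`; TAKING line HOME/STATUS.md 2026-08-23T00:16Z; free-target protocol G.5-34(d) — SOURCE: the
successor item declared by p34 gen 16 in the HONEST SCOPE of `BIJ88NeumannPropagatorSmallFieldRegion` (p344577): *"the k-uniform ‖f‖_∞
member needs the free tilted row bound of p27's route (`BIJ85FreeResolventTiltedRow`, whole torus, d ≤ 3) on the region, not done here"*,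
which is p31 gen 20's DISPLAYED HYPOTHESIS (H1.10) of `BIJ88DeltaLocClose235General` at `X = □_α`).  WHAT IS REPRODUCED: nothing printed
is restated here — this file is the ENGINE (the box analogue of p27 gen 32's `BIJ85FreeResolventTorus` §§1–4 and `BIJ85FreeResolventTiltedRow`
§§6–7, which serve the whole torus) behind a located member of rows **C2.Eq2.30** (`HOME/lit-balaban-r18/ROWS-C2.md`, owner r18: *"[6]'s
propagator estimates stay displayed hypotheses"* — here the (1.10) VALUE member in OPERATOR form for the cubes `□_α` of (2.27) at non-flat
`u`) and **C1.Eq7.3.1-7.3.2** (`HOME/lit-balaban-r15/ROWS-C1.md`, owner r15: the p. 326 sentence *"estimates for G_k(Λ₃,u) … by an extension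
of the proofs of [7]"*), proved in the sibling file.  Kind «model-level theorems only» (no new definition, no `Prop`-valued fact introduced:
`R_□` is b04's `(B4BoxCov237.boxOpR n 0 m² M)⁻¹`, `G_□` is `(boxOpR n a_k 0 M)⁻¹`).

THE PRINTED TEXT (verbatim).  C2 p. 262–263 [PDF 6–7]: *"In the scalar field sector, we have the η-lattice propagators G_k(Ω,u) defined on
subsets Ω ⊂ T_η with Neumann boundary conditions. To localize the dependence on u, we interpolate in a smooth fashion between operators with
Neumann boundary conditions on small cubes. … a straightforward application of the random walk expansion of [6] shows that
|(G_{k,loc}(u)f)(x)| ≦ ce^{−c dist(suppt f,x)}‖f‖_∞, (2.30)"*.  [I] p. 326 [PDF 28]: *"These inequalities can be proved by an extension of the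
proofs of [7]. The propagators arising from Δ_k(u_k), under the restriction (7.3.1) on the gauge field, also satisfy the regularity and decay
estimates of [7]."*  [6] (2.44) p. 584 (as transcribed in `B4BoxCov237.boxOpR`): the operator of (1.6) in lattice units on the box
`X = Π[0, n·M_μ)`, *"n²(−Δ^N_X) + m2 + (a/n^{d+1})·1_{same n-block}"*; [B3] (2.6) p. 424 and (2.10) p. 426 as quoted in `B3Ineq210ZeroBox`.

THE OBJECTS (all b04/p38/p03, with bodies; nothing defined here).  The box `□ = Π_i[0, nM_i) ⊂ ℤ^{d+1}` (`B4Reflection242.boxDom`, points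
`↥(boxDom (fun i => n * M i))`, box bonds `boxNbrs`, `n`-blocks `boxBlk`); [6]'s zero-field box operator in lattice units
`H_G = boxOpR n a 0 M = n²(−Δ^N_□) + a·n^{−(d+1)}1_{same block}` and its inverse `G_□`; the FREE MASSIVE NEUMANN operator
`H = boxOpR n 0 m² M = n²(−Δ^N_□) + m²` (no block term) and `R_□ = H⁻¹`; at `n = L^k`, `a = a_k = B1.aSeq a L k`, `m² = 1` these are, through
p31's cube chart `cubePt`/`cubeT` and up to the factor `(L^kε)²`, the flat cube propagator `G_k(□,1)` of (2.27) (p31 `gBox_cube_eq`) and the free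
massive Neumann resolvent `(ε^{−2}(−Δ^N_□) + (L^kε)^{−2})⁻¹` of the fine torus cube — one unit of mass on the block scale, the comparison
operator of Kato's inequality in the sibling file.

THE MECHANISM (p27 gen 32's whole-torus route, ported to [6]'s box; DIVERGENCE OF METHOD from the printed random-walk expansion disclosed —
the tilted row bound is the one place where a multiscale structure enters, through the B3 (2.6)/(2.10) box pieces of the pub-balaban/p03
lineage, used BY NAME).  (§1) `(Hv)(z) = n²Σ_{z′∼z}(v(z) − v(z′)) + m²v(z)` (`boxH_mulVec`); MINIMUM PRINCIPLE (`Hv ≥ 0 ⟹ v ≥ 0`), hence `H`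
invertible, `R_□ ≥ 0` entrywise, COMPARISON `Hv ≤ g ⟹ v ≤ R_□g`, row sums `1/m²`, symmetry.  (§2) the bilinear form
`ψ·Hφ = (n²/2)ΣΣ(ψ−ψ′)(φ−φ′) + m²ψ·φ` and the FREE AGMON (Combes–Thomas) bound `‖wR_□g‖₂ ≤ ‖wg‖₂/(m² − (d+1)n²S₁)` for weights with
bond oscillation `(w−w′)² ≤ S₁ww′` (energy method, test function `w²φ`).  (§3) the block term `K = H_G − H = a·n^{−D}J_blk − m²`
(`boxK_mulVec`) and the tilted `ℓ²` bound of the block average `Σ(w·n^{−D}J_blku)² ≤ e^{2t}Σ(wu)²` (Cauchy–Schwarz in the block, double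
counting).  (§4) the RESOLVENT IDENTITY `R_□ = G_□ + R_□KG_□`.  (§5) radial sums `Σ_{z′∈□}e^{−δ|z−z′|_∞/b} ≤ (2(1+D/δ))^Db^D`
(`B4BoxCov237.rho_sumBound` + the private kernel `latticeConst_scale_le`).  (§6) THE TILTED ROW OF `G_□`: `G_□ = Σ_{j<k}G^η_{(j)}(□,0)` (p03
`sum_piece_eq_inv`) with `|G^η_{(j)}(z,x)| ≤ C·L^{−jD}(L^jη)²e^{−δ₁|z−x|/L^j}` (`abs_piece_le`, `η = L^{−k}`); a weighted Cauchy–Schwarz over the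
scales with weights `q^j`, `q = √(L^{4−D}) > 1` (`D ≤ 3`), and the radial sums give `Σ_z e^{2t|x−z|/L^k}G_□(z,x)² ≤ C²K_δ/(q−1)²·L^{−kD}` for
`t ≤ δ₁/2` (`tilted_row_boxG_sq_le`).  (§7) the weight `w = e^{t|x−·|_∞/n}` has bond oscillation `(t/n)²e^{t/n}` and block oscillation `e^t`;
applying the resolvent identity to `δ_x`, `R_□δ_x = u + R_□(Ku)`, `u = G_□δ_x`: `Σ(wR_□(x,·))² ≤ 2W(u) + 2·4·(2a_k²e^{2t} + 2)W(u) ≤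
(18 + 16a²e)·C₁L^{−kD}` by §2 with `κ = (d+1)t²e^{t/n} ≤ 1/2` (`t ≤ 1/(2(d+1))`) and §3 (`tilted_row_boxR_sq_le`).

WHAT IS PROVED (theorems only; 0 `sorry`; standard axioms; no new definition, no `Prop`-valued fact).
* §1 **`boxH_mulVec`**, **`nonneg_of_boxH_mulVec_nonneg`** (minimum principle), **`isUnit_boxH`**, `boxH_mul_inv`, `inv_mul_boxH`,
  **`boxR_mulVec_nonneg`**, **`le_boxR_mulVec`** (comparison), `boxR_apply_nonneg`, `boxH_mulVec_const`, `boxR_mulVec_const`,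
  **`sum_boxR_apply`** (row sums `1/m²`), `boxH_transpose`, `boxR_transpose`, `boxInv_apply_eq_mulVec_single`.
* §2 `dotProduct_boxH_mulVec`, **`agmon_free_box`**.
* §3 **`boxK_mulVec`**, **`tilted_sq_blockAvg_le`**.
* §4 **`resolvent_identity_box`**.
* §5 **`sum_exp_neg_supNorm_scale_le`** (private kernel `latticeConst_scale_le`).
* §6 **`tilted_row_boxG_sq_le`** (`D = d + 1 ≤ 3`; `∃ t₁ C₁ > 0` from `(d, ℓ, a)`: ∀ `k ≥ 1`, ∀ box, ∀ `0 ≤ t ≤ t₁`, ∀ `x`: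
  `Σ_z (e^{t|x−z|_∞/L^k}G_□(z,x))² ≤ C₁/(L^k)^D`).
* §7 `boxWeight_bond_osc`, `boxWeight_block_osc`, **`tilted_row_boxR_sq_le`** (`∃ t₀ C₀ > 0` from `(d, ℓ, a)`: ∀ `k ≥ 1`, ∀ box
  `□ = Π_i[0, L^kM_i)`, ∀ `0 ≤ t ≤ t₀`, ∀ `x ∈ □`: `Σ_y (e^{t|x−y|_∞/L^k}R_□(x,y))² ≤ C₀/(L^k)^D`, `R_□ = (boxOpR (L^k) 0 1 M)⁻¹`).

HONEST SCOPE.  (i) Pure lattice analysis on [6]'s box carrier: no gauge field, no torus; the transfer to p31's cube propagators of record is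
the sibling file's.  (ii) `D = d + 1 ≤ 3` in §§6–7 (the scale sum `Σ_{j<k}L^{j(4−D)}` must be dominated by its top term; `D = 4` would cost a
factor `k`); §§1–5 hold in every dimension.  (iii) The mass of §7 is fixed to ONE unit on the block scale (`m² = 1` in lattice units = the
`(L^kε)^{−2}` of the sibling file); §§1–4 hold for every `m² > 0`.  (iv) Constants existential but explicit in the proofs (`t₁ = δ₁/2`,
`C₁ = C²K_δ/(q−1)²` from p03's `(δ₁, C)`; `t₀ = min(t₁, 1/(2D))`, `C₀ = (18 + 16a²e)C₁`), depending on `(d, ℓ, a)` only — uniform in the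
scale `k ≥ 1` and in the box `M`.  (v) `set_option maxHeartbeats 400000` on §7's theorem (long bookkeeping, no automation beyond
`linarith`/`nlinarith`/`ring`).  DIVERGENCE OF METHOD as stated (Agmon/Kato route in place of [6]'s random walk; disclosed in every lineage
file).  Nothing here is summit progress.  Unit `lit-balaban-p27` (literature-prover-lit-balaban-p27-g34-0), HOME
`run/shared/lean/pub/lit-balaban/`, 2026-08-23.
-/

open scoped BigOperators
open Finset Matrix

namespace Literature.MathematicalPhysics.QuantumFieldTheory.BalabanImbrieJaffe1984to88.BIJ88FreeNeumannResolventBox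

open Literature.MathematicalPhysics.QuantumFieldTheory.Balaban1983to89
open B4ContourShift (supNorm supNorm_nonneg)
open B4Reflection242 (boxDom mem_boxDom blk blk_mem_boxDom)
open B4Green242Bridge (boxNbrs boxBlk mem_boxNbrs_comm not_mem_boxNbrs_self mem_boxBlk_self)
open B4BoxCov237 (opBoxR boxOpR opBoxR_mulVec boxOpR_isSymm sum_boxNbrs_commR card_filter_blk)
open B4Sect5Proof (latticeConst latticeConst_nonneg)

noncomputable section

variable {d : ℕ} {n : ℕ} {M : Fin (d + 1) → ℕ}

/-! ## §1 The free massive Neumann operator `H = n²(−Δ^N_□) + m²` on [6]'s box `□ = Π_i[0, nM_i)` (b04's `boxOpR n 0 m² M`):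
pointwise action, minimum principle, invertibility, positivity and monotonicity of `R_□ = H⁻¹`, row sums `1/m²` -/

/-- **`(Hv)(z) = n²Σ_{z′ ∼ z, z′ ∈ □}(v(z) − v(z′)) + m²v(z)`** — [6]'s box operator (2.44) in lattice units at `a = 0` (no block term):
the free massive NEUMANN Laplacian of the box. [cite: Balaban1983RegularityDecay, p.584 (2.44)] -/
theorem boxH_mulVec (m2 : ℝ) (v : ↥(boxDom (fun i => n * M i)) → ℝ) (z : ↥(boxDom (fun i => n * M i))) :
    (boxOpR n 0 m2 M *ᵥ v) z = (n : ℝ) ^ 2 * (∑ y ∈ boxNbrs (fun i => n * M i) z, (v z - v y)) + m2 * v z := by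
  rw [boxOpR, opBoxR_mulVec, zero_mul, zero_mul, add_zero]

/-- kernel: the box is inhabited (`n ≥ 1`, `M_i ≥ 1`). [folklore] -/
private theorem zero_mem_boxDom (hn : 1 ≤ n) (hM : ∀ i, 1 ≤ M i) : (0 : Fin (d + 1) → ℤ) ∈ boxDom (fun i => n * M i) := by
  rw [mem_boxDom]
  intro i
  refine ⟨le_rfl, ?_⟩
  have : 1 ≤ n * M i := Nat.one_le_iff_ne_zero.2 (Nat.mul_ne_zero (by omega) (by have := hM i; omega))
  simp only [Pi.zero_apply]
  exact_mod_cast this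

/-- **MINIMUM PRINCIPLE** for `n²(−Δ^N_□) + m²`, `m² > 0`: if `(Hv)(z) ≥ 0` at every box point then `v ≥ 0` (at a minimum point `z₀`
of `v` every difference `v(z₀) − v(z′)` is `≤ 0`, so `0 ≤ (Hv)(z₀) ≤ m²v(z₀)`). [cite: Balaban1983RegularityDecay, p.584 (2.44)] -/
theorem nonneg_of_boxH_mulVec_nonneg (hn : 1 ≤ n) (hM : ∀ i, 1 ≤ M i) {m2 : ℝ} (hm : 0 < m2)
    (v : ↥(boxDom (fun i => n * M i)) → ℝ) (h : ∀ z, 0 ≤ (boxOpR n 0 m2 M *ᵥ v) z) : ∀ z, 0 ≤ v z := by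
  have hne : (univ : Finset ↥(boxDom (fun i => n * M i))).Nonempty := ⟨⟨0, zero_mem_boxDom hn hM⟩, mem_univ _⟩
  obtain ⟨z₀, -, hz₀⟩ := exists_min_image univ v hne
  have hle : (boxOpR n 0 m2 M *ᵥ v) z₀ ≤ m2 * v z₀ := by
    rw [boxH_mulVec]
    have hs : ∑ y ∈ boxNbrs (fun i => n * M i) z₀, (v z₀ - v y) ≤ 0 :=
      sum_nonpos fun y _ => sub_nonpos.2 (hz₀ y (mem_univ _))
    nlinarith [sq_nonneg (n : ℝ)]
  have h0 : 0 ≤ v z₀ := by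
    by_contra hneg
    have : m2 * v z₀ < 0 := mul_neg_of_pos_of_neg hm (lt_of_not_ge hneg)
    linarith [h z₀]
  exact fun z => h0.trans (hz₀ z (mem_univ _))

/-- **`H = n²(−Δ^N_□) + m²` IS INVERTIBLE** for `m² > 0` (injectivity from the minimum principle applied to `±v`).
[cite: Balaban1983RegularityDecay, p.584 (2.44)] -/
theorem isUnit_boxH (hn : 1 ≤ n) (hM : ∀ i, 1 ≤ M i) {m2 : ℝ} (hm : 0 < m2) : IsUnit (boxOpR n 0 m2 M) := by
  rw [← Matrix.mulVec_injective_iff_isUnit]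
  intro v v' hvv'
  have hz : boxOpR n 0 m2 M *ᵥ (v - v') = 0 := by rw [mulVec_sub, hvv', sub_self]
  have h1 := nonneg_of_boxH_mulVec_nonneg hn hM hm (v - v') fun x => by rw [hz]; rfl
  have h2 := nonneg_of_boxH_mulVec_nonneg hn hM hm (v' - v) fun x => by
    rw [show v' - v = -(v - v') by abel, mulVec_neg, hz, neg_zero]; rfl
  funext x
  have a := h1 x; have b := h2 x
  simp only [Pi.sub_apply] at a b
  linarith

/-- kernel: `H·H⁻¹ = 1`. [cite: Balaban1983RegularityDecay, p.584 (2.44)] -/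
theorem boxH_mul_inv (hn : 1 ≤ n) (hM : ∀ i, 1 ≤ M i) {m2 : ℝ} (hm : 0 < m2) : boxOpR n 0 m2 M * (boxOpR n 0 m2 M)⁻¹ = 1 :=
  mul_nonsing_inv _ ((isUnit_iff_isUnit_det _).mp (isUnit_boxH hn hM hm))

/-- kernel: `H⁻¹·H = 1`. [cite: Balaban1983RegularityDecay, p.584 (2.44)] -/
theorem inv_mul_boxH (hn : 1 ≤ n) (hM : ∀ i, 1 ≤ M i) {m2 : ℝ} (hm : 0 < m2) : (boxOpR n 0 m2 M)⁻¹ * boxOpR n 0 m2 M = 1 :=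
  nonsing_inv_mul _ ((isUnit_iff_isUnit_det _).mp (isUnit_boxH hn hM hm))

/-- **THE FREE NEUMANN RESOLVENT IS POSITIVITY PRESERVING**: `g ≥ 0 ⟹ R_□g ≥ 0`, `R_□ = (n²(−Δ^N_□) + m²)⁻¹`.
[cite: Balaban1983RegularityDecay, p.584 (2.44)] -/
theorem boxR_mulVec_nonneg (hn : 1 ≤ n) (hM : ∀ i, 1 ≤ M i) {m2 : ℝ} (hm : 0 < m2) {g : ↥(boxDom (fun i => n * M i)) → ℝ}
    (hg : ∀ z, 0 ≤ g z) (z : ↥(boxDom (fun i => n * M i))) : 0 ≤ ((boxOpR n 0 m2 M)⁻¹ *ᵥ g) z :=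
  nonneg_of_boxH_mulVec_nonneg hn hM hm _ (fun y => by rw [mulVec_mulVec, boxH_mul_inv hn hM hm, one_mulVec]; exact hg y) z

/-- **COMPARISON PRINCIPLE**: `Hv ≤ g` pointwise ⟹ `v ≤ R_□g` pointwise. [cite: Balaban1983RegularityDecay, p.584 (2.44)] -/
theorem le_boxR_mulVec (hn : 1 ≤ n) (hM : ∀ i, 1 ≤ M i) {m2 : ℝ} (hm : 0 < m2) {v g : ↥(boxDom (fun i => n * M i)) → ℝ}
    (h : ∀ z, (boxOpR n 0 m2 M *ᵥ v) z ≤ g z) (z : ↥(boxDom (fun i => n * M i))) : v z ≤ ((boxOpR n 0 m2 M)⁻¹ *ᵥ g) z := by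
  have key := nonneg_of_boxH_mulVec_nonneg hn hM hm ((boxOpR n 0 m2 M)⁻¹ *ᵥ g - v) (fun y => by
    rw [mulVec_sub, mulVec_mulVec, boxH_mul_inv hn hM hm, one_mulVec, Pi.sub_apply]
    exact sub_nonneg.2 (h y)) z
  rw [Pi.sub_apply] at key
  linarith

/-- kernel: the entries of `R_□` are nonnegative. [cite: Balaban1983RegularityDecay, p.584 (2.44)] -/
theorem boxR_apply_nonneg (hn : 1 ≤ n) (hM : ∀ i, 1 ≤ M i) {m2 : ℝ} (hm : 0 < m2) (z y : ↥(boxDom (fun i => n * M i))) :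
    0 ≤ (boxOpR n 0 m2 M)⁻¹ z y := by
  classical
  have h := boxR_mulVec_nonneg hn hM hm (g := Pi.single y 1) (fun x => by
    by_cases hx : x = y
    · subst hx; simp
    · simp [hx]) z
  rwa [mulVec_single, MulOpposite.op_one, one_smul] at h

/-- kernel: `H` applied to the constant `c` is the constant `m²c` (the Neumann Laplacian kills constants). [cite: Balaban1983RegularityDecay, p.584 (2.44)] -/
theorem boxH_mulVec_const (m2 c : ℝ) (z : ↥(boxDom (fun i => n * M i))) :
    (boxOpR n 0 m2 M *ᵥ fun _ => c) z = m2 * c := by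
  rw [boxH_mulVec]; simp

/-- kernel: `R_□` applied to the constant `c` is the constant `c/m²`. [cite: Balaban1983RegularityDecay, p.584 (2.44)] -/
theorem boxR_mulVec_const (hn : 1 ≤ n) (hM : ∀ i, 1 ≤ M i) {m2 : ℝ} (hm : 0 < m2) (c : ℝ) :
    (boxOpR n 0 m2 M)⁻¹ *ᵥ (fun _ : ↥(boxDom (fun i => n * M i)) => c) = fun _ => c / m2 := by
  have h1 : boxOpR n 0 m2 M *ᵥ (fun _ : ↥(boxDom (fun i => n * M i)) => c / m2) = fun _ => c := by
    funext x; rw [boxH_mulVec_const]; field_simp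
  rw [← h1, mulVec_mulVec, inv_mul_boxH hn hM hm, one_mulVec]

/-- kernel: **the row sums of `R_□` are `1/m²`**. [cite: Balaban1983RegularityDecay, p.584 (2.44)] -/
theorem sum_boxR_apply (hn : 1 ≤ n) (hM : ∀ i, 1 ≤ M i) {m2 : ℝ} (hm : 0 < m2) (z : ↥(boxDom (fun i => n * M i))) :
    ∑ y, (boxOpR n 0 m2 M)⁻¹ z y = 1 / m2 := by
  have h := congrFun (boxR_mulVec_const hn hM hm (1 : ℝ)) z
  simp only [mulVec, dotProduct, mul_one] at h
  exact h

/-- kernel: `H` is symmetric. [cite: Balaban1983RegularityDecay, p.584 (2.44)] -/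
theorem boxH_transpose (a m2 : ℝ) : (boxOpR n a m2 M)ᵀ = boxOpR n a m2 M := boxOpR_isSymm n a m2 M

/-- kernel: `R_□` is symmetric. [cite: Balaban1983RegularityDecay, p.584 (2.44)] -/
theorem boxR_transpose (a m2 : ℝ) : ((boxOpR n a m2 M)⁻¹)ᵀ = (boxOpR n a m2 M)⁻¹ := by
  rw [transpose_nonsing_inv, boxH_transpose]

/-- kernel: the row of the symmetric resolvent is its column: `R(z,y) = (R·δ_z)(y)`. [cite: Balaban1983RegularityDecay, p.584 (2.44)] -/
theorem boxInv_apply_eq_mulVec_single (a m2 : ℝ) (z y : ↥(boxDom (fun i => n * M i))) :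
    (boxOpR n a m2 M)⁻¹ z y = ((boxOpR n a m2 M)⁻¹ *ᵥ Pi.single z (1 : ℝ)) y := by
  classical
  rw [mulVec_single, MulOpposite.op_one, one_smul, Matrix.col_apply]
  calc (boxOpR n a m2 M)⁻¹ z y = ((boxOpR n a m2 M)⁻¹)ᵀ y z := (transpose_apply _ _ _).symm
    _ = (boxOpR n a m2 M)⁻¹ y z := by rw [boxR_transpose]

/-! ## §2 The bilinear form of `H` and the free Agmon (Combes–Thomas) bound in the weighted `ℓ²` norm -/

/-- kernel: the bilinear form of the box operator: `ψ·(Hφ) = (n²/2)Σ_zΣ_{z′∼z}(ψ(z) − ψ(z′))(φ(z) − φ(z′)) + m²(ψ·φ)` (symmetrization over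
the box bonds, each unordered bond counted twice). [cite: Balaban1983RegularityDecay, p.584 (2.44)] -/
theorem dotProduct_boxH_mulVec (m2 : ℝ) (ψ φ : ↥(boxDom (fun i => n * M i)) → ℝ) :
    ψ ⬝ᵥ (boxOpR n 0 m2 M *ᵥ φ) =
      (n : ℝ) ^ 2 / 2 * (∑ z, ∑ y ∈ boxNbrs (fun i => n * M i) z, (ψ z - ψ y) * (φ z - φ y)) + m2 * (ψ ⬝ᵥ φ) := by
  set T : ↥(boxDom (fun i => n * M i)) → ℝ := fun z => ∑ y ∈ boxNbrs (fun i => n * M i) z, ψ z * (φ z - φ y) with hT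
  have hpt : ∀ z, ψ z * (boxOpR n 0 m2 M *ᵥ φ) z = (n : ℝ) ^ 2 * T z + m2 * (ψ z * φ z) := by
    intro z
    rw [boxH_mulVec]
    have h : ψ z * ∑ y ∈ boxNbrs (fun i => n * M i) z, (φ z - φ y) = T z := by rw [hT, mul_sum]
    linear_combination (n : ℝ) ^ 2 * h
  have hsym : ∑ z, ∑ y ∈ boxNbrs (fun i => n * M i) z, ψ y * (φ z - φ y) =
      ∑ z, ∑ y ∈ boxNbrs (fun i => n * M i) z, ψ z * (φ y - φ z) :=
    sum_boxNbrs_commR fun z y => ψ y * (φ z - φ y)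
  have e2 : ∑ z, ∑ y ∈ boxNbrs (fun i => n * M i) z, ψ z * (φ y - φ z) = -∑ z, T z := by
    rw [← sum_neg_distrib]; refine sum_congr rfl fun z _ => ?_
    rw [hT, ← sum_neg_distrib]; refine sum_congr rfl fun y _ => ?_; ring
  have key : ∑ z, ∑ y ∈ boxNbrs (fun i => n * M i) z, (ψ z - ψ y) * (φ z - φ y) = 2 * ∑ z, T z := by
    have e : ∑ z, ∑ y ∈ boxNbrs (fun i => n * M i) z, (ψ z - ψ y) * (φ z - φ y) =
        ∑ z, T z - ∑ z, ∑ y ∈ boxNbrs (fun i => n * M i) z, ψ y * (φ z - φ y) := by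
      rw [← sum_sub_distrib]; refine sum_congr rfl fun z _ => ?_
      rw [hT, ← sum_sub_distrib]; refine sum_congr rfl fun y _ => ?_; ring
    rw [e, hsym, e2]; ring
  unfold dotProduct
  simp_rw [hpt]
  rw [sum_add_distrib, ← mul_sum, ← mul_sum, key]
  ring

/-- kernel: every box point has at most `2(d+1)` box neighbours. [folklore] -/
private theorem card_boxNbrs_le' (z : ↥(boxDom (fun i => n * M i))) : ((boxNbrs (fun i => n * M i) z).card : ℝ) ≤ 2 * (d + 1) := by
  have h : (boxNbrs (fun i => n * M i) z).card ≤ 2 * (d + 1) := by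
    rw [B4Green242Bridge.card_boxNbrs, ← B4Reflection242.card_nbrs z.1]
    exact card_filter_le _ _
  exact_mod_cast h

/-- **THE FREE AGMON BOUND ON THE BOX**: for a positive weight `w` with `(w(z) − w(z′))² ≤ S₁·w(z)w(z′)` on every box bond and
`κ₀ := (d+1)·n²·S₁ < m²`, the free Neumann resolvent satisfies `‖w·R_□g‖₂ ≤ ‖w·g‖₂/(m² − κ₀)` (energy method: test `Hφ = g` against
`w²φ`; the bond identity `(w²φ − w′²φ′)(φ − φ′) = (wφ − w′φ′)² − (w − w′)²φφ′` is second order in the oscillation of `w`). Stated with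
squares. [cite: BalabanImbrieJaffe1988, (2.30) p.263] -/
theorem agmon_free_box (hn : 1 ≤ n) (hM : ∀ i, 1 ≤ M i) {m2 : ℝ} (hm : 0 < m2) {w : ↥(boxDom (fun i => n * M i)) → ℝ} {S₁ : ℝ}
    (hS₁ : 0 ≤ S₁) (hwpos : ∀ z, 0 < w z)
    (hw : ∀ z, ∀ y ∈ boxNbrs (fun i => n * M i) z, (w z - w y) ^ 2 ≤ S₁ * (w z * w y))
    (hκ : (d + 1) * (n : ℝ) ^ 2 * S₁ < m2) (g : ↥(boxDom (fun i => n * M i)) → ℝ) :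
    ∑ z, (w z * ((boxOpR n 0 m2 M)⁻¹ *ᵥ g) z) ^ 2 ≤ (∑ z, (w z * g z) ^ 2) / (m2 - (d + 1) * (n : ℝ) ^ 2 * S₁) ^ 2 := by
  set φ : ↥(boxDom (fun i => n * M i)) → ℝ := (boxOpR n 0 m2 M)⁻¹ *ᵥ g with hφ
  set κ : ℝ := (d + 1) * (n : ℝ) ^ 2 * S₁ with hκdef
  have hHφ : boxOpR n 0 m2 M *ᵥ φ = g := by rw [hφ, mulVec_mulVec, boxH_mul_inv hn hM hm, one_mulVec]
  set A2 : ℝ := ∑ z, (w z * φ z) ^ 2 with hA2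
  set B2 : ℝ := ∑ z, (w z * g z) ^ 2 with hB2
  have hA2nn : 0 ≤ A2 := sum_nonneg fun z _ => sq_nonneg _
  have hB2nn : 0 ≤ B2 := sum_nonneg fun z _ => sq_nonneg _
  set ψ : ↥(boxDom (fun i => n * M i)) → ℝ := fun z => w z ^ 2 * φ z with hψ
  -- (1) `ψ·g ≤ √A2·√B2`
  have h1 : ψ ⬝ᵥ (boxOpR n 0 m2 M *ᵥ φ) ≤ Real.sqrt A2 * Real.sqrt B2 := by
    rw [hHφ]
    have hcs := sum_mul_sq_le_sq_mul_sq univ (fun z => w z * φ z) (fun z => w z * g z)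
    have e : ψ ⬝ᵥ g = ∑ z, (w z * φ z) * (w z * g z) := by
      simp only [dotProduct, hψ]; exact sum_congr rfl fun z _ => by ring
    rw [e, ← Real.sqrt_mul hA2nn]
    refine Real.le_sqrt_of_sq_le ?_
    rw [hA2, hB2]
    exact hcs
  -- (2) `ψ·(Hφ) ≥ (m² − κ)A2`
  have h2 : (m2 - κ) * A2 ≤ ψ ⬝ᵥ (boxOpR n 0 m2 M *ᵥ φ) := by
    rw [dotProduct_boxH_mulVec]
    have eψφ : ψ ⬝ᵥ φ = A2 := by
      simp only [dotProduct, hψ, hA2]; exact sum_congr rfl fun z _ => by ring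
    rw [eψφ]
    -- each ordered bond contributes `≥ −(S₁/2)((wφ)(z)² + (wφ)(z′)²)`
    have hpt : ∀ z, ∀ y ∈ boxNbrs (fun i => n * M i) z,
        -(S₁ / 2 * ((w z * φ z) ^ 2 + (w y * φ y) ^ 2)) ≤ (ψ z - ψ y) * (φ z - φ y) := by
      intro z y hy
      simp only [hψ]
      have hid : (w z ^ 2 * φ z - w y ^ 2 * φ y) * (φ z - φ y) =
          (w z * φ z - w y * φ y) ^ 2 - (w z - w y) ^ 2 * (φ z * φ y) := by ring
      rw [hid]
      have hsq : 0 ≤ (w z * φ z - w y * φ y) ^ 2 := sq_nonneg _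
      have hcross : (w z - w y) ^ 2 * (φ z * φ y) ≤ S₁ / 2 * ((w z * φ z) ^ 2 + (w y * φ y) ^ 2) := by
        have hab : |φ z * φ y| * (w z * w y) ≤ ((w z * φ z) ^ 2 + (w y * φ y) ^ 2) / 2 := by
          rw [abs_mul]
          have := two_mul_le_add_sq (w z * |φ z|) (w y * |φ y|)
          have hw1 := (hwpos z).le; have hw2 := (hwpos y).le
          nlinarith [sq_abs (φ z), sq_abs (φ y), abs_nonneg (φ z), abs_nonneg (φ y)]
        calc (w z - w y) ^ 2 * (φ z * φ y) ≤ (w z - w y) ^ 2 * |φ z * φ y| :=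
              mul_le_mul_of_nonneg_left (le_abs_self _) (sq_nonneg _)
          _ ≤ S₁ * (w z * w y) * |φ z * φ y| := mul_le_mul_of_nonneg_right (hw z y hy) (abs_nonneg _)
          _ = S₁ * (|φ z * φ y| * (w z * w y)) := by ring
          _ ≤ S₁ * (((w z * φ z) ^ 2 + (w y * φ y) ^ 2) / 2) := mul_le_mul_of_nonneg_left hab hS₁
          _ = S₁ / 2 * ((w z * φ z) ^ 2 + (w y * φ y) ^ 2) := by ring
      linarith
    have hsum : -(S₁ / 2) * ∑ z, ∑ y ∈ boxNbrs (fun i => n * M i) z, ((w z * φ z) ^ 2 + (w y * φ y) ^ 2) ≤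
        ∑ z, ∑ y ∈ boxNbrs (fun i => n * M i) z, (ψ z - ψ y) * (φ z - φ y) := by
      rw [mul_sum]
      refine sum_le_sum fun z _ => ?_
      rw [mul_sum]
      refine sum_le_sum fun y hy => ?_
      have := hpt z y hy
      linarith
    -- the double sum of the squares is `2Σ_z deg(z)(wφ)(z)² ≤ 4(d+1)A2`
    have hdeg : ∑ z, ∑ y ∈ boxNbrs (fun i => n * M i) z, ((w z * φ z) ^ 2 + (w y * φ y) ^ 2) ≤ 4 * (d + 1) * A2 := by
      have hsym : ∑ z, ∑ y ∈ boxNbrs (fun i => n * M i) z, (w y * φ y) ^ 2 = ∑ z, ∑ y ∈ boxNbrs (fun i => n * M i) z, (w z * φ z) ^ 2 :=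
        sum_boxNbrs_commR fun z y => (w y * φ y) ^ 2
      rw [sum_congr rfl fun z _ => sum_add_distrib, sum_add_distrib, hsym, ← two_mul]
      have hz : ∀ z, ∑ y ∈ boxNbrs (fun i => n * M i) z, (w z * φ z) ^ 2 ≤ 2 * (d + 1) * (w z * φ z) ^ 2 := by
        intro z
        rw [sum_const, nsmul_eq_mul]
        exact mul_le_mul_of_nonneg_right (card_boxNbrs_le' z) (sq_nonneg _)
      calc 2 * ∑ z, ∑ y ∈ boxNbrs (fun i => n * M i) z, (w z * φ z) ^ 2 ≤ 2 * ∑ z, 2 * (d + 1) * (w z * φ z) ^ 2 :=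
            mul_le_mul_of_nonneg_left (sum_le_sum fun z _ => hz z) zero_le_two
        _ = 4 * (d + 1) * A2 := by rw [← mul_sum, hA2]; ring
    have hn2 : 0 ≤ (n : ℝ) ^ 2 / 2 := by positivity
    have hmain : (n : ℝ) ^ 2 / 2 * (-(S₁ / 2) * (4 * (d + 1) * A2)) ≤
        (n : ℝ) ^ 2 / 2 * ∑ z, ∑ y ∈ boxNbrs (fun i => n * M i) z, (ψ z - ψ y) * (φ z - φ y) := by
      refine mul_le_mul_of_nonneg_left (le_trans ?_ hsum) hn2
      have hS' : -(S₁ / 2) ≤ 0 := by linarith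
      exact mul_le_mul_of_nonpos_left hdeg hS'
    have e3 : (m2 - κ) * A2 = (n : ℝ) ^ 2 / 2 * (-(S₁ / 2) * (4 * (d + 1) * A2)) + m2 * A2 := by rw [hκdef]; ring
    rw [e3]
    linarith
  -- (3) conclude
  have hmk : 0 < m2 - κ := by rw [hκdef]; linarith
  have h3 : (m2 - κ) * A2 ≤ Real.sqrt A2 * Real.sqrt B2 := h2.trans h1
  have h4 : (m2 - κ) * Real.sqrt A2 ≤ Real.sqrt B2 := by
    by_cases hA : Real.sqrt A2 = 0
    · rw [hA, mul_zero]; exact Real.sqrt_nonneg _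
    · have hApos : 0 < Real.sqrt A2 := lt_of_le_of_ne (Real.sqrt_nonneg _) (Ne.symm hA)
      have e : (m2 - κ) * A2 = ((m2 - κ) * Real.sqrt A2) * Real.sqrt A2 := by
        rw [mul_assoc, Real.mul_self_sqrt hA2nn]
      rw [e, mul_comm (Real.sqrt A2) (Real.sqrt B2)] at h3
      exact le_of_mul_le_mul_right h3 hApos
  have h5 : ((m2 - κ) * Real.sqrt A2) ^ 2 ≤ (Real.sqrt B2) ^ 2 :=
    pow_le_pow_left₀ (mul_nonneg hmk.le (Real.sqrt_nonneg _)) h4 2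
  rw [mul_pow, Real.sq_sqrt hA2nn, Real.sq_sqrt hB2nn] at h5
  rw [le_div_iff₀ (pow_pos hmk 2)]
  linarith

/-! ## §3 The block term: `K = H_G − H_R = a·n^{−D}J_blk − m²` and the tilted `ℓ²` bound of the block average -/

/-- kernel: the block of a fine box point has `n^{d+1}` points. [folklore] -/
private theorem card_boxBlk (hn : 1 ≤ n) (z : ↥(boxDom (fun i => n * M i))) :
    ((boxBlk n (fun i => n * M i) z).card : ℝ) = (n : ℝ) ^ (d + 1) := by
  have h := card_filter_blk hn M ⟨blk n z.1, blk_mem_boxDom hn z.2⟩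
  unfold boxBlk
  exact_mod_cast h

/-- kernel: membership in a block is symmetric. [folklore] -/
private theorem mem_boxBlk_comm {b : ℕ} {N : Fin (d + 1) → ℕ} {x y : ↥(boxDom N)} : y ∈ boxBlk b N x ↔ x ∈ boxBlk b N y := by
  unfold boxBlk; simp only [mem_filter, mem_univ, true_and]; exact eq_comm

/-- **`((H_G − H_R)u)(z) = a·n^{−(d+1)}Σ_{z′ ∈ block(z)}u(z′) − m²u(z)`** — the difference of [6]'s zero-field box operator
`H_G = n²(−Δ^N_□) + a·n^{−(d+1)}1_{same block}` ((2.44), `m² = 0`) and the free massive Neumann operator `H_R = n²(−Δ^N_□) + m²` is the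
block averaging term minus the mass. [cite: Balaban1983RegularityDecay, p.584 (2.44)] -/
theorem boxK_mulVec (a m2 : ℝ) (u : ↥(boxDom (fun i => n * M i)) → ℝ) (z : ↥(boxDom (fun i => n * M i))) :
    ((boxOpR n a 0 M - boxOpR n 0 m2 M) *ᵥ u) z =
      a * ((n : ℝ) ^ (d + 1))⁻¹ * (∑ y ∈ boxBlk n (fun i => n * M i) z, u y) - m2 * u z := by
  rw [sub_mulVec, Pi.sub_apply, boxH_mulVec, boxOpR, opBoxR_mulVec]
  ring

/-- **TILTED `ℓ²` BOUND OF THE BLOCK AVERAGE ON THE BOX**: if the positive weight `w` oscillates by at most the factor `e^t` inside every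
`n`-block, `Σ_z w(z)²(n^{−(d+1)}Σ_{block(z)}u)² ≤ e^{2t}Σ_z w(z)²u(z)²` (Cauchy–Schwarz in the block and double counting).
[cite: BalabanImbrieJaffe1988, (2.30) p.263] -/
theorem tilted_sq_blockAvg_le (hn : 1 ≤ n) {w : ↥(boxDom (fun i => n * M i)) → ℝ} {t : ℝ} (hwpos : ∀ z, 0 < w z)
    (hosc : ∀ z y : ↥(boxDom (fun i => n * M i)), y ∈ boxBlk n (fun i => n * M i) z → w z ≤ Real.exp t * w y)
    (u : ↥(boxDom (fun i => n * M i)) → ℝ) :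
    ∑ z, (w z * (((n : ℝ) ^ (d + 1))⁻¹ * ∑ y ∈ boxBlk n (fun i => n * M i) z, u y)) ^ 2 ≤
      Real.exp (2 * t) * ∑ z, (w z * u z) ^ 2 := by
  classical
  set ω : ℝ := ((n : ℝ) ^ (d + 1))⁻¹ with hω
  have hnpos : (0 : ℝ) < (n : ℝ) ^ (d + 1) := by positivity
  have hωpos : 0 < ω := inv_pos.2 hnpos
  have hcard : ∀ z : ↥(boxDom (fun i => n * M i)), ω * ((boxBlk n (fun i => n * M i) z).card : ℝ) = 1 := fun z => by
    rw [card_boxBlk hn z, hω, inv_mul_cancel₀ hnpos.ne']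
  -- pointwise: `(w z·ω·Σ_B u)² ≤ ω·e^{2t}·Σ_{z′ ∈ B(z)} (w z′ u z′)²`
  have hpt : ∀ z : ↥(boxDom (fun i => n * M i)),
      (w z * (ω * ∑ y ∈ boxBlk n (fun i => n * M i) z, u y)) ^ 2 ≤
        ω * Real.exp (2 * t) * ∑ y ∈ boxBlk n (fun i => n * M i) z, (w y * u y) ^ 2 := by
    intro z
    set B := boxBlk n (fun i => n * M i) z with hB
    have hcs : (∑ y ∈ B, u y) ^ 2 ≤ (B.card : ℝ) * ∑ y ∈ B, u y ^ 2 := sq_sum_le_card_mul_sum_sq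
    have hwt : ∀ y ∈ B, w z ^ 2 * u y ^ 2 ≤ Real.exp (2 * t) * (w y * u y) ^ 2 := by
      intro y hy
      have h := hosc z y hy
      have hsq : w z ^ 2 ≤ (Real.exp t * w y) ^ 2 := pow_le_pow_left₀ (hwpos z).le h 2
      have e2 : (Real.exp t * w y) ^ 2 = Real.exp (2 * t) * w y ^ 2 := by
        rw [mul_pow, ← Real.exp_nat_mul]; norm_num
      rw [e2] at hsq
      nlinarith [sq_nonneg (u y), sq_nonneg (w y)]
    calc (w z * (ω * ∑ y ∈ B, u y)) ^ 2 = ω * (w z ^ 2 * (ω * (∑ y ∈ B, u y) ^ 2)) := by ring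
      _ ≤ ω * (w z ^ 2 * (ω * ((B.card : ℝ) * ∑ y ∈ B, u y ^ 2))) := by gcongr
      _ = ω * ∑ y ∈ B, w z ^ 2 * u y ^ 2 := by
          congr 1
          calc w z ^ 2 * (ω * ((B.card : ℝ) * ∑ y ∈ B, u y ^ 2)) = (ω * (B.card : ℝ)) * (w z ^ 2 * ∑ y ∈ B, u y ^ 2) := by ring
            _ = ∑ y ∈ B, w z ^ 2 * u y ^ 2 := by rw [hcard z, one_mul, mul_sum]
      _ ≤ ω * ∑ y ∈ B, Real.exp (2 * t) * (w y * u y) ^ 2 :=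
          mul_le_mul_of_nonneg_left (sum_le_sum fun y hy => hwt y hy) hωpos.le
      _ = ω * Real.exp (2 * t) * ∑ y ∈ B, (w y * u y) ^ 2 := by rw [← mul_sum, mul_assoc]
  refine (sum_le_sum fun z _ => hpt z).trans ?_
  -- double counting: `Σ_z Σ_{z′ ∈ B(z)} F z′ = Σ_{z′} #B(z′)·F z′`
  rw [← mul_sum]
  have hdc : ∑ z : ↥(boxDom (fun i => n * M i)), ∑ y ∈ boxBlk n (fun i => n * M i) z, (w y * u y) ^ 2 =
      ∑ y : ↥(boxDom (fun i => n * M i)), ((boxBlk n (fun i => n * M i) y).card : ℝ) * (w y * u y) ^ 2 := by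
    rw [Finset.sum_comm' (t' := univ) (s' := fun y => boxBlk n (fun i => n * M i) y)
      (fun z y => ⟨fun h => ⟨mem_boxBlk_comm.1 h.2, mem_univ _⟩, fun h => ⟨mem_univ _, mem_boxBlk_comm.1 h.1⟩⟩)]
    refine sum_congr rfl fun y _ => ?_
    rw [sum_const, nsmul_eq_mul]
  rw [hdc, mul_sum, mul_sum]
  refine sum_le_sum fun y _ => le_of_eq ?_
  calc ω * Real.exp (2 * t) * (((boxBlk n (fun i => n * M i) y).card : ℝ) * (w y * u y) ^ 2)
      = (ω * ((boxBlk n (fun i => n * M i) y).card : ℝ)) * (Real.exp (2 * t) * (w y * u y) ^ 2) := by ring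
    _ = Real.exp (2 * t) * (w y * u y) ^ 2 := by rw [hcard y, one_mul]

/-! ## §4 The resolvent identity between the free Neumann resolvent `R_□` and [6]'s zero-field box Green's function `G_□` -/

/-- **THE RESOLVENT IDENTITY ON THE BOX**: `R_□ = G_□ + R_□·(a·n^{−(d+1)}J_blk − m²)·G_□` with `R_□ = (n²(−Δ^N_□) + m²)⁻¹` and
`G_□ = (n²(−Δ^N_□) + a·n^{−(d+1)}1_{same block})⁻¹` ([6] (2.44) at zero field, zero mass). [cite: Balaban1983RegularityDecay, p.584 (2.44)] -/
theorem resolvent_identity_box (hn : 1 ≤ n) (hM : ∀ i, 1 ≤ M i) {a : ℝ} (ha : 0 < a) {m2 : ℝ} (hm : 0 < m2) :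
    (boxOpR n 0 m2 M)⁻¹ = (boxOpR n a 0 M)⁻¹ +
      (boxOpR n 0 m2 M)⁻¹ * (boxOpR n a 0 M - boxOpR n 0 m2 M) * (boxOpR n a 0 M)⁻¹ := by
  have h1 : boxOpR n a 0 M * (boxOpR n a 0 M)⁻¹ = 1 := B4BoxCov237.boxOpR_mul_inv hn ha le_rfl hM
  have h2 : (boxOpR n 0 m2 M)⁻¹ * boxOpR n 0 m2 M = 1 := inv_mul_boxH hn hM hm
  rw [Matrix.mul_sub, Matrix.sub_mul, Matrix.mul_assoc, h1, Matrix.mul_one, h2, Matrix.one_mul]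
  abel

/-! ## §5 Radial sums at the scale `b`: `Σ_{z′ ∈ □} e^{−δ|z−z′|_∞/b} ≤ (2(1 + (d+1)/δ))^{d+1}·b^{d+1}` -/

/-- kernel: `(1 − e^{−s})⁻¹ ≤ 1 + 1/s` for `s > 0`. [folklore] -/
private theorem inv_one_sub_exp_neg_le {s : ℝ} (hs : 0 < s) : (1 - Real.exp (-s))⁻¹ ≤ 1 + 1 / s := by
  have h1 : s + 1 ≤ Real.exp s := Real.add_one_le_exp s
  have hexp : 0 < Real.exp s := Real.exp_pos s
  have h2 : Real.exp (-s) ≤ 1 / (s + 1) := by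
    rw [Real.exp_neg, inv_eq_one_div]
    exact one_div_le_one_div_of_le (by linarith) h1
  have h3 : s / (s + 1) ≤ 1 - Real.exp (-s) := by
    have e : s / (s + 1) = 1 - 1 / (s + 1) := by field_simp; ring
    rw [e]; linarith
  have h4 : 0 < s / (s + 1) := by positivity
  calc (1 - Real.exp (-s))⁻¹ ≤ (s / (s + 1))⁻¹ := inv_anti₀ h4 h3
    _ = 1 + 1 / s := by field_simp

/-- kernel: the uniform lattice constant at the rate `δ/b` grows like `b^{D}`: `K_D(δ/b) ≤ (2(1 + D/δ))^D·b^D` for `b ≥ 1`. [folklore] -/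
private theorem latticeConst_scale_le (D : ℕ) {δ : ℝ} (hδ : 0 < δ) {b : ℝ} (hb : 1 ≤ b) :
    latticeConst D (δ / b) ≤ (2 * (1 + D / δ)) ^ D * b ^ D := by
  rcases Nat.eq_zero_or_pos D with hD | hD
  · subst hD; simp [latticeConst]
  have hDpos : (0 : ℝ) < D := by exact_mod_cast hD
  have hbpos : 0 < b := by linarith
  unfold latticeConst
  rw [← mul_pow]
  refine pow_le_pow_left₀ (mul_nonneg zero_le_two (inv_nonneg.2 ?_)) ?_ D
  · have : Real.exp (-(δ / b / D)) ≤ 1 := Real.exp_le_one_iff.2 (by have := div_pos (div_pos hδ hbpos) hDpos; linarith)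
    linarith
  have hs : 0 < δ / b / D := div_pos (div_pos hδ hbpos) hDpos
  have h := inv_one_sub_exp_neg_le hs
  have e : 1 + 1 / (δ / b / D) = 1 + D / δ * b := by field_simp
  rw [e] at h
  have h2 : 1 + D / δ * b ≤ (1 + D / δ) * b := by nlinarith [div_nonneg hDpos.le hδ.le]
  calc 2 * (1 - Real.exp (-(δ / b / D)))⁻¹ ≤ 2 * (1 + D / δ * b) := by linarith
    _ ≤ 2 * ((1 + D / δ) * b) := by linarith
    _ = 2 * (1 + D / δ) * b := by ring

/-- kernel: **the radial sum of the decay factor at scale `b` over a box**, uniform in the box: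
`Σ_{z′ ∈ □} e^{−δ|z−z′|_∞/b} ≤ (2(1 + (d+1)/δ))^{d+1}·b^{d+1}`. [cite: Balaban1983Higgs3, p.427] -/
theorem sum_exp_neg_supNorm_scale_le {N : Fin (d + 1) → ℕ} {δ : ℝ} (hδ : 0 < δ) {b : ℝ} (hb : 1 ≤ b) (z : ↥(boxDom N)) :
    ∑ y : ↥(boxDom N), Real.exp (-(δ * supNorm (z.1 - y.1) / b)) ≤ (2 * (1 + (d + 1 : ℕ) / δ)) ^ (d + 1) * b ^ (d + 1) := by
  have hbpos : 0 < b := by linarith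
  have h := B4BoxCov237.rho_sumBound N (δ / b) (div_pos hδ hbpos) z
  have e : ∀ y : ↥(boxDom N), Real.exp (-(δ * supNorm (z.1 - y.1) / b)) = Real.exp (-(δ / b * B4BoxCov237.rho N z y)) := fun y => by
    unfold B4BoxCov237.rho; congr 1; ring
  simp_rw [e]
  exact h.trans (latticeConst_scale_le (d + 1) hδ hb)

/-! ## §6 The tilted row bound of [6]'s zero-field box Green's function `G_□ = (n²(−Δ^N_□) + a_kn^{−D}1_{same block})⁻¹` from the
B3 (2.6)/(2.10) scale pieces (`B3Ineq210ZeroBox.sum_piece_eq_inv`, `abs_piece_le`), `D = d + 1 ≤ 3` -/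

section TiltedRows

open B4Thm110ZeroBox (Nf bj sc)
open B3Ineq210ZeroBox (piece sum_piece_eq_inv abs_piece_le)

/-- kernel: `x^{2−D}`-bookkeeping: `((L^iη)²/(L^iη)^D)²·(L^i)^D/q^i = η⁴/η^{2D}·q^i` with `q² = L^{4−D}` (`D ≤ 4`). [folklore] -/
private theorem scale_identity {L : ℝ} (hL : 0 < L) {η : ℝ} (hη : 0 < η) {D : ℕ} (hD : D ≤ 4) (i : ℕ) :
    ((L ^ i * η) ^ 2 / (L ^ i * η) ^ D) ^ 2 * (L ^ i) ^ D / (Real.sqrt (L ^ (4 - D))) ^ i =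
      η ^ 4 / η ^ (2 * D) * (Real.sqrt (L ^ (4 - D))) ^ i := by
  set q := Real.sqrt (L ^ (4 - D)) with hq
  have hq2 : q ^ 2 = L ^ (4 - D) := by rw [hq, Real.sq_sqrt (pow_nonneg hL.le _)]
  have hqpos : 0 < q := Real.sqrt_pos.2 (pow_pos hL _)
  have hL4 : L ^ (4 * i) = (q ^ 2) ^ i * (L ^ D) ^ i := by
    rw [hq2, ← pow_mul, ← pow_mul, ← pow_add]
    congr 1
    have : (4 - D) * i + D * i = 4 * i := by rw [← Nat.add_mul, Nat.sub_add_cancel hD]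
    omega
  have hLi : 0 < L ^ i := pow_pos hL i
  have hηD : 0 < η ^ D := pow_pos hη D
  have hLi4 : (L ^ i) ^ 4 = (q ^ 2) ^ i * (L ^ D) ^ i := by rw [← pow_mul, mul_comm i 4, hL4]
  field_simp
  rw [hLi4]
  ring

/-- kernel: for `D ≤ 3` and `L ≥ 2` the ratio `q = √(L^{4−D})` of the scale sum exceeds `1`. [folklore] -/
private theorem one_lt_sqrt_pow {L : ℝ} (hL : 1 < L) {D : ℕ} (hD : D ≤ 3) : 1 < Real.sqrt (L ^ (4 - D)) := by
  rw [show (1 : ℝ) = Real.sqrt 1 by rw [Real.sqrt_one]]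
  exact Real.sqrt_lt_sqrt zero_le_one (one_lt_pow₀ hL (by omega))

/-- kernel: the block side `b_j = L^j` as a real number. [folklore] -/
private theorem bj_cast (ℓ j : ℕ) : ((bj ℓ j : ℕ) : ℝ) = ((ℓ : ℝ) + 1) ^ j := by
  show (((ℓ + 1) ^ j : ℕ) : ℝ) = _
  push_cast
  ring

/-- kernel: the prefactor of the piece bound in the `η`-bookkeeping: `L^{−jD}·L^{−2(k−j)} = η^D·(s_j²/s_j^D)`, `η = L^{−k}`, `s_j = L^jη`
(`j ≤ k`). [folklore] -/
private theorem piece_prefactor_eq (ℓ : ℕ) {k j : ℕ} (hjk : j ≤ k) :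
    ((((bj ℓ j : ℕ) : ℝ) ^ (d + 1))⁻¹ * (sc ℓ k j ^ 2)⁻¹) =
      ((((ℓ : ℝ) + 1) ^ k)⁻¹) ^ (d + 1) *
        ((((ℓ : ℝ) + 1) ^ j * (((ℓ : ℝ) + 1) ^ k)⁻¹) ^ 2 / (((ℓ : ℝ) + 1) ^ j * (((ℓ : ℝ) + 1) ^ k)⁻¹) ^ (d + 1)) := by
  set L : ℝ := (ℓ : ℝ) + 1 with hL
  have hLpos : 0 < L := by rw [hL]; positivity
  have hLj : L ^ j ≠ 0 := pow_ne_zero _ hLpos.ne'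
  have hLk : L ^ k ≠ 0 := pow_ne_zero _ hLpos.ne'
  rw [bj_cast, sc, ← hL, pow_sub₀ L hLpos.ne' hjk]
  field_simp
  ring

/-- **THE TILTED ROW BOUND OF THE ZERO-FIELD BOX GREEN'S FUNCTION** (`D = d + 1 ≤ 3`): there are `t₁, C₁ > 0` (functions of `d, ℓ, a`)
with `Σ_{z ∈ □} e^{2t|x−z|_∞/L^k}·G_□(z,x)² ≤ C₁·L^{−kD}` for every scale `k ≥ 1`, every box `□ = Π_i[0, L^kM_i)`, every `0 ≤ t ≤ t₁`
and every box point `x`, where `G_□ = (L^{2k}(−Δ^N_□) + a_kL^{−kD}1_{same block})⁻¹ = Σ_{j<k}G^η_{(j)}(□,0)` is [6]'s zero-field box Green's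
function in lattice units ((2.44); b04/p38's `(boxOpR (L^k) a_k 0 M)⁻¹`) — from the multiscale kernel bounds
`|G^η_{(j)}(z,x)| ≤ C·L^{−jD}(L^jη)²e^{−δ₁|z−x|/L^j}` of [Balaban1983Higgs3] (2.10) for the box pieces (p03's `B3Ineq210ZeroBox.abs_piece_le`) by
a weighted Cauchy–Schwarz over the scales `j < k` with weights `q^j`, `q = √(L^{4−D})`, and the radial sums of §5.
[cite: BalabanImbrieJaffe1988, (2.30) p.263] -/
theorem tilted_row_boxG_sq_le (d ℓ : ℕ) (hd3 : d + 1 ≤ 3) (hℓ : 1 ≤ ℓ) {a : ℝ} (ha : 0 < a) :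
    ∃ t₁ C₁ : ℝ, 0 < t₁ ∧ 0 < C₁ ∧ ∀ k : ℕ, 1 ≤ k → ∀ (M : Fin (d + 1) → ℕ), (∀ i, 1 ≤ M i) →
      ∀ t : ℝ, 0 ≤ t → t ≤ t₁ → ∀ x : ↥(boxDom (Nf ℓ k M)),
        ∑ z : ↥(boxDom (Nf ℓ k M)), (Real.exp (t * supNorm (x.1 - z.1) / ((ℓ : ℝ) + 1) ^ k) *
            (boxOpR ((ℓ + 1) ^ k) (B1.aSeq a ((ℓ : ℝ) + 1) k) 0 M)⁻¹ z x) ^ 2 ≤ C₁ / (((ℓ : ℝ) + 1) ^ k) ^ (d + 1) := by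
  obtain ⟨δ, C, hδ, hC, hpiece⟩ := abs_piece_le d ℓ hℓ a a 0 ha
  set L : ℝ := (ℓ : ℝ) + 1 with hLdef
  have hℓ1 : (1 : ℝ) ≤ ℓ := by exact_mod_cast hℓ
  have hL1 : 1 < L := by rw [hLdef]; linarith
  have hLpos : 0 < L := by linarith
  set q : ℝ := Real.sqrt (L ^ (4 - (d + 1))) with hq
  have hq1 : 1 < q := one_lt_sqrt_pow hL1 hd3
  have hqpos : 0 < q := zero_lt_one.trans hq1
  set Kδ : ℝ := (2 * (1 + ((d + 1 : ℕ) : ℝ) / δ)) ^ (d + 1) with hKδ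
  have hKδ_pos : 0 < Kδ := by positivity
  refine ⟨δ / 2, C ^ 2 * Kδ / (q - 1) ^ 2, by linarith, by have := sub_pos.2 hq1; positivity, ?_⟩
  intro k hk1 M hM t ht0 ht1 x
  -- notation: `η = L^{−k}`, the scales `s_i = L^iη`, the weight, the decay factors, the scale sum
  set η : ℝ := (L ^ k)⁻¹ with hη
  have hLk : 0 < L ^ k := pow_pos hLpos k
  have hηpos : 0 < η := inv_pos.2 hLk
  have hLkη : L ^ k * η = 1 := mul_inv_cancel₀ hLk.ne'
  set s : ℕ → ℝ := fun i => L ^ i * η with hs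
  have hspos : ∀ i, 0 < s i := fun i => mul_pos (pow_pos hLpos i) hηpos
  set w : ↥(boxDom (Nf ℓ k M)) → ℝ := fun z => Real.exp (t * supNorm (x.1 - z.1) / L ^ k) with hw
  set f : ℕ → ↥(boxDom (Nf ℓ k M)) → ℝ := fun i z =>
    s i ^ 2 / s i ^ (d + 1) * Real.exp (-(δ / 2 * supNorm (x.1 - z.1) / L ^ i)) with hf
  have hf_nn : ∀ i z, 0 ≤ f i z := fun i z => by
    simp only [hf]; exact mul_nonneg (div_nonneg (sq_nonneg _) (pow_nonneg (hspos i).le _)) (Real.exp_pos _).le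
  set Sq : ℝ := ∑ i ∈ range k, q ^ i with hSq
  have hSq_pos : 0 < Sq := by
    rw [hSq]; exact sum_pos (fun i _ => pow_pos hqpos i) ⟨0, mem_range.2 hk1⟩
  set G : Matrix ↥(boxDom (Nf ℓ k M)) ↥(boxDom (Nf ℓ k M)) ℝ := (boxOpR ((ℓ + 1) ^ k) (B1.aSeq a ((ℓ : ℝ) + 1) k) 0 M)⁻¹ with hGdef
  -- (P1) pointwise: `|w z·G(z,x)| ≤ η^D·C·Σ_{i<k} f i z`
  have hP1 : ∀ z : ↥(boxDom (Nf ℓ k M)), |w z * G z x| ≤ η ^ (d + 1) * C * ∑ i ∈ range k, f i z := by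
    intro z
    have hG : G z x = ∑ i ∈ range k, piece ℓ k M i a 0 z x := by
      rw [hGdef, ← sum_piece_eq_inv (ℓ := ℓ) (M := M) (a := a) (m2 := 0) hk1, Matrix.sum_apply]
    have hwpos : 0 < w z := Real.exp_pos _
    rw [hG, mul_sum]
    refine (abs_sum_le_sum_abs _ _).trans ?_
    rw [mul_sum]
    refine sum_le_sum fun i hi => ?_
    have hik : i < k := mem_range.1 hi
    rw [abs_mul, abs_of_pos hwpos]
    have hb := hpiece k hk1 i hik a 0 le_rfl le_rfl le_rfl le_rfl M hM z x
    rw [piece_prefactor_eq ℓ hik.le, ← hLdef, bj_cast, ← hLdef] at hb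
    -- the exponent bookkeeping: `t/L^k ≤ δ/(2L^i)` and `|z−x| = |x−z|`
    have hLi : 0 < L ^ i := pow_pos hLpos i
    have hLik : L ^ i ≤ L ^ k := pow_le_pow_right₀ hL1.le hik.le
    have hsupp : supNorm (z.1 - x.1) = supNorm (x.1 - z.1) := by rw [← B4TorusKernel.supNorm_neg, neg_sub]
    have hexp : w z * Real.exp (-(δ * supNorm (z.1 - x.1) / L ^ i)) ≤ Real.exp (-(δ / 2 * supNorm (x.1 - z.1) / L ^ i)) := by
      rw [hw, ← Real.exp_add, hsupp]
      refine Real.exp_le_exp.2 ?_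
      have hs0 : 0 ≤ supNorm (x.1 - z.1) := supNorm_nonneg _
      have h1 : t * supNorm (x.1 - z.1) / L ^ k ≤ δ / 2 * supNorm (x.1 - z.1) / L ^ i := by
        rw [div_le_div_iff₀ hLk hLi]
        calc t * supNorm (x.1 - z.1) * L ^ i ≤ δ / 2 * supNorm (x.1 - z.1) * L ^ i := by gcongr
          _ ≤ δ / 2 * supNorm (x.1 - z.1) * L ^ k := by gcongr
      have e : -(δ / 2 * supNorm (x.1 - z.1) / L ^ i) =
          δ / 2 * supNorm (x.1 - z.1) / L ^ i + -(δ * supNorm (x.1 - z.1) / L ^ i) := by ring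
      rw [e]; exact add_le_add h1 le_rfl
    have hpre : 0 ≤ C * (η ^ (d + 1) * (s i ^ 2 / s i ^ (d + 1))) := by positivity
    calc w z * |piece ℓ k M i a 0 z x|
        ≤ w z * (C * (η ^ (d + 1) * (s i ^ 2 / s i ^ (d + 1))) * Real.exp (-(δ * supNorm (z.1 - x.1) / L ^ i))) :=
          mul_le_mul_of_nonneg_left hb hwpos.le
      _ = C * (η ^ (d + 1) * (s i ^ 2 / s i ^ (d + 1))) * (w z * Real.exp (-(δ * supNorm (z.1 - x.1) / L ^ i))) := by ring
      _ ≤ C * (η ^ (d + 1) * (s i ^ 2 / s i ^ (d + 1))) * Real.exp (-(δ / 2 * supNorm (x.1 - z.1) / L ^ i)) :=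
          mul_le_mul_of_nonneg_left hexp hpre
      _ = η ^ (d + 1) * C * f i z := by simp only [hf, hs]; ring
  -- (P2) pointwise square with the weighted Cauchy–Schwarz over the scales
  have hP2 : ∀ z : ↥(boxDom (Nf ℓ k M)),
      (w z * G z x) ^ 2 ≤ (η ^ (d + 1) * C) ^ 2 * (Sq * ∑ i ∈ range k, (f i z) ^ 2 / q ^ i) := by
    intro z
    have h1 : (w z * G z x) ^ 2 ≤ (η ^ (d + 1) * C * ∑ i ∈ range k, f i z) ^ 2 := by
      rw [← sq_abs (w z * _)]
      exact pow_le_pow_left₀ (abs_nonneg _) (hP1 z) 2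
    have hcs : (∑ i ∈ range k, f i z) ^ 2 ≤ Sq * ∑ i ∈ range k, (f i z) ^ 2 / q ^ i := by
      have h := Finset.sq_sum_div_le_sum_sq_div (range k) (fun i => f i z) (g := fun i => q ^ i) (fun i _ => pow_pos hqpos i)
      rwa [div_le_iff₀ hSq_pos, mul_comm] at h
    calc (w z * G z x) ^ 2 ≤ (η ^ (d + 1) * C * ∑ i ∈ range k, f i z) ^ 2 := h1
      _ = (η ^ (d + 1) * C) ^ 2 * (∑ i ∈ range k, f i z) ^ 2 := by ring
      _ ≤ (η ^ (d + 1) * C) ^ 2 * (Sq * ∑ i ∈ range k, (f i z) ^ 2 / q ^ i) :=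
          mul_le_mul_of_nonneg_left hcs (sq_nonneg _)
  -- (P3) the `z`-sum of `f i z²` at each scale
  have hP3 : ∀ i : ℕ, ∑ z : ↥(boxDom (Nf ℓ k M)), (f i z) ^ 2 / q ^ i ≤ Kδ * (η ^ 4 / η ^ (2 * (d + 1))) * q ^ i := by
    intro i
    have hLi1 : 1 ≤ L ^ i := one_le_pow₀ hL1.le
    have hrad := sum_exp_neg_supNorm_scale_le (N := Nf ℓ k M) hδ hLi1 x
    have e1 : ∀ z : ↥(boxDom (Nf ℓ k M)), (f i z) ^ 2 / q ^ i =
        (s i ^ 2 / s i ^ (d + 1)) ^ 2 / q ^ i * Real.exp (-(δ * supNorm (x.1 - z.1) / L ^ i)) := by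
      intro z
      simp only [hf]
      rw [mul_pow, ← Real.exp_nat_mul]
      have e : ((2 : ℕ) : ℝ) * -(δ / 2 * supNorm (x.1 - z.1) / L ^ i) = -(δ * supNorm (x.1 - z.1) / L ^ i) := by
        push_cast; ring
      rw [e]; ring
    simp_rw [e1]
    rw [← mul_sum]
    have hpref : 0 ≤ (s i ^ 2 / s i ^ (d + 1)) ^ 2 / q ^ i := by positivity
    refine (mul_le_mul_of_nonneg_left hrad hpref).trans (le_of_eq ?_)
    have hsc := scale_identity hLpos hηpos (show d + 1 ≤ 4 by omega) i
    simp only [hs]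
    calc ((L ^ i * η) ^ 2 / (L ^ i * η) ^ (d + 1)) ^ 2 / q ^ i * ((2 * (1 + ((d + 1 : ℕ) : ℝ) / δ)) ^ (d + 1) * (L ^ i) ^ (d + 1))
        = (2 * (1 + ((d + 1 : ℕ) : ℝ) / δ)) ^ (d + 1) *
            (((L ^ i * η) ^ 2 / (L ^ i * η) ^ (d + 1)) ^ 2 * (L ^ i) ^ (d + 1) / q ^ i) := by ring
      _ = Kδ * (η ^ 4 / η ^ (2 * (d + 1)) * q ^ i) := by rw [hsc]
      _ = Kδ * (η ^ 4 / η ^ (2 * (d + 1))) * q ^ i := by ring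
  -- (P4) assemble
  have hmain : ∑ z, (w z * G z x) ^ 2 ≤ C ^ 2 * Kδ * η ^ 4 * Sq ^ 2 := by
    calc ∑ z, (w z * G z x) ^ 2
        ≤ ∑ z, (η ^ (d + 1) * C) ^ 2 * (Sq * ∑ i ∈ range k, (f i z) ^ 2 / q ^ i) := sum_le_sum fun z _ => hP2 z
      _ = (η ^ (d + 1) * C) ^ 2 * Sq * ∑ i ∈ range k, ∑ z, (f i z) ^ 2 / q ^ i := by
          rw [← mul_sum, sum_comm, ← mul_sum, mul_assoc]
      _ ≤ (η ^ (d + 1) * C) ^ 2 * Sq * ∑ i ∈ range k, Kδ * (η ^ 4 / η ^ (2 * (d + 1))) * q ^ i := by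
          gcongr with i hi
          exact hP3 i
      _ = C ^ 2 * Kδ * η ^ 4 * Sq ^ 2 := by
          rw [← mul_sum, ← hSq]
          have hε : η ^ (2 * (d + 1)) = (η ^ (d + 1)) ^ 2 := by rw [pow_mul']
          rw [hε]
          have hεd : (η ^ (d + 1)) ^ 2 ≠ 0 := pow_ne_zero _ (pow_ne_zero _ hηpos.ne')
          field_simp
  -- the scale sum: `Sq ≤ q^k/(q−1)`, `Sq² ≤ L^{(4−D)k}/(q−1)²`, and `η⁴L^{(4−D)k} = 1/L^{kD}`
  have hq1' : q - 1 ≠ 0 := (sub_pos.2 hq1).ne'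
  have hSq_le : Sq ≤ q ^ k / (q - 1) := by
    rw [hSq, geom_sum_eq hq1.ne', div_le_div_iff_of_pos_right (sub_pos.2 hq1)]
    linarith [pow_pos hqpos k]
  have hSq2 : Sq ^ 2 ≤ L ^ ((4 - (d + 1)) * k) / (q - 1) ^ 2 := by
    have h := pow_le_pow_left₀ hSq_pos.le hSq_le 2
    rw [div_pow, ← pow_mul, mul_comm k 2, pow_mul, show q ^ 2 = L ^ (4 - (d + 1)) by
      rw [hq, Real.sq_sqrt (pow_nonneg hLpos.le _)], ← pow_mul] at h
    exact h
  have hscale : η ^ 4 * L ^ ((4 - (d + 1)) * k) = 1 / (L ^ k) ^ (d + 1) := by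
    rw [eq_div_iff (pow_ne_zero _ hLk.ne'), hη]
    have e : (4 - (d + 1)) * k + k * (d + 1) = k * 4 := by
      have h4 : (4 - (d + 1)) + (d + 1) = 4 := Nat.sub_add_cancel (by omega)
      calc (4 - (d + 1)) * k + k * (d + 1) = ((4 - (d + 1)) + (d + 1)) * k := by ring
        _ = k * 4 := by rw [h4, mul_comm]
    calc ((L ^ k)⁻¹) ^ 4 * L ^ ((4 - (d + 1)) * k) * (L ^ k) ^ (d + 1)
        = ((L ^ k)⁻¹) ^ 4 * (L ^ ((4 - (d + 1)) * k) * L ^ (k * (d + 1))) := by rw [← pow_mul]; ring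
      _ = ((L ^ k)⁻¹) ^ 4 * L ^ ((4 - (d + 1)) * k + k * (d + 1)) := by rw [pow_add]
      _ = ((L ^ k)⁻¹) ^ 4 * (L ^ k) ^ 4 := by rw [e, pow_mul]
      _ = 1 := by rw [← mul_pow, inv_mul_cancel₀ hLk.ne', one_pow]
  calc ∑ z, (w z * G z x) ^ 2 ≤ C ^ 2 * Kδ * η ^ 4 * Sq ^ 2 := hmain
    _ ≤ C ^ 2 * Kδ * η ^ 4 * (L ^ ((4 - (d + 1)) * k) / (q - 1) ^ 2) := by gcongr
    _ = C ^ 2 * Kδ / (q - 1) ^ 2 * (η ^ 4 * L ^ ((4 - (d + 1)) * k)) := by field_simp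
    _ = C ^ 2 * Kδ / (q - 1) ^ 2 / (L ^ k) ^ (d + 1) := by rw [hscale]; ring

end TiltedRows

/-! ## §7 The exponential weight `e^{t|x−z|_∞/n}` on the box: bond and block oscillation; the tilted row bound of `R_□` -/

section Weight

open B4Reflection242 (nbrs mem_nbrs_iff_sub supNorm_le_of_forall)

/-- kernel: box neighbours are at sup-distance `≤ 1`. [folklore] -/
private theorem supNorm_sub_le_one_of_mem_boxNbrs {N : Fin (d + 1) → ℕ} {z y : ↥(boxDom N)} (hy : y ∈ boxNbrs N z) :
    supNorm (z.1 - y.1) ≤ 1 := by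
  have hy' : y.1 ∈ nbrs z.1 := by
    unfold boxNbrs at hy; exact (mem_filter.1 hy).2
  obtain ⟨i, hi⟩ := mem_nbrs_iff_sub.1 hy'
  have e : z.1 - y.1 = -(y.1 - z.1) := by abel
  rw [e, B4TorusKernel.supNorm_neg]
  refine supNorm_le_of_forall fun j => ?_
  rcases hi with h | h <;> rw [h]
  · by_cases hj : j = i
    · subst hj; simp
    · simp [Pi.single_eq_of_ne hj]
  · by_cases hj : j = i
    · subst hj; simp
    · simp [Pi.single_eq_of_ne hj]

/-- kernel: the weight `e^{t|x−·|_∞/n}` oscillates across a box bond by `(w − w′)² ≤ (t/n)²e^{t/n}·ww′`. [cite: BalabanImbrieJaffe1988, (2.30) p.263] -/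
theorem boxWeight_bond_osc {N : Fin (d + 1) → ℕ} {t : ℝ} (ht : 0 ≤ t) {nr : ℝ} (hn : 0 < nr) (x : ↥(boxDom N))
    {z y : ↥(boxDom N)} (hy : y ∈ boxNbrs N z) :
    (Real.exp (t * supNorm (x.1 - z.1) / nr) - Real.exp (t * supNorm (x.1 - y.1) / nr)) ^ 2 ≤
      (t / nr) ^ 2 * Real.exp (t / nr) * (Real.exp (t * supNorm (x.1 - z.1) / nr) * Real.exp (t * supNorm (x.1 - y.1) / nr)) := by
  refine BIJ85AgmonDefect.sq_exp_sub_exp_le_of_abs_le ?_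
  have h1 := B4Thm110ZeroBox.supNorm_sub_le_sub_add_sub x.1 z.1 y.1
  have h2 := B4Thm110ZeroBox.supNorm_sub_le_sub_add_sub x.1 y.1 z.1
  have h3 := supNorm_sub_le_one_of_mem_boxNbrs hy
  have h4 : supNorm (y.1 - z.1) ≤ 1 := by rw [← B4TorusKernel.supNorm_neg, neg_sub]; exact h3
  rw [← sub_div, ← mul_sub, abs_div, abs_mul, abs_of_nonneg ht, abs_of_pos hn, div_le_div_iff₀ hn hn]
  have h5 : |supNorm (x.1 - z.1) - supNorm (x.1 - y.1)| ≤ 1 := abs_sub_le_iff.2 ⟨by linarith, by linarith⟩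
  calc t * |supNorm (x.1 - z.1) - supNorm (x.1 - y.1)| * nr = (t * nr) * |supNorm (x.1 - z.1) - supNorm (x.1 - y.1)| := by ring
    _ ≤ (t * nr) * 1 := mul_le_mul_of_nonneg_left h5 (mul_nonneg ht hn.le)
    _ = t * nr := mul_one _

/-- kernel: inside an `n`-block the weight `e^{t|x−·|_∞/n}` varies by at most the factor `e^t`. [cite: BalabanImbrieJaffe1988, (2.30) p.263] -/
theorem boxWeight_block_osc (hn : 1 ≤ n) {t : ℝ} (ht : 0 ≤ t) (x : ↥(boxDom (fun i => n * M i)))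
    (z y : ↥(boxDom (fun i => n * M i))) (hy : y ∈ boxBlk n (fun i => n * M i) z) :
    Real.exp (t * supNorm (x.1 - z.1) / n) ≤ Real.exp t * Real.exp (t * supNorm (x.1 - y.1) / n) := by
  rw [← Real.exp_add]
  refine Real.exp_le_exp.2 ?_
  have hblk : blk n y.1 = blk n z.1 := by unfold boxBlk at hy; exact (mem_filter.1 hy).2
  have h1 : supNorm (z.1 - y.1) ≤ (n : ℝ) - 1 := B4BoxCov237.supNorm_sub_le_of_blk_eq hn hblk.symm
  have h2 := B4Thm110ZeroBox.supNorm_sub_le_sub_add_sub x.1 y.1 z.1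
  have h3 : supNorm (y.1 - z.1) ≤ (n : ℝ) - 1 := by rw [← B4TorusKernel.supNorm_neg, neg_sub]; exact h1
  have hnr : (0 : ℝ) < n := by exact_mod_cast hn
  have h4 : t * supNorm (x.1 - z.1) / n ≤ t * (supNorm (x.1 - y.1) + n) / n := by
    gcongr; linarith
  calc t * supNorm (x.1 - z.1) / n ≤ t * (supNorm (x.1 - y.1) + n) / n := h4
    _ = t + t * supNorm (x.1 - y.1) / n := by field_simp; ring

end Weight

section TiltedRowR

open B4Thm110ZeroBox (Nf)

/-- kernel: `(a + b)² ≤ 2a² + 2b²`. [folklore] -/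
private theorem add_sq_le_two (a b : ℝ) : (a + b) ^ 2 ≤ 2 * a ^ 2 + 2 * b ^ 2 := by nlinarith [sq_nonneg (a - b)]

set_option maxHeartbeats 400000 in
/-- **THE TILTED ROW BOUND OF THE FREE MASSIVE NEUMANN RESOLVENT ON THE BOX** (`D = d + 1 ≤ 3`): with one unit of mass on the block
scale, `R_□ = (L^{2k}(−Δ^N_□) + 1)⁻¹` on `□ = Π_i[0, L^kM_i)`, there are `t₀, C₀ > 0` (functions of `d, ℓ, a`) such that for every scale
`k ≥ 1`, every box, every `0 ≤ t ≤ t₀` and every box point `x`: `Σ_{y ∈ □} e^{2t|x−y|_∞/L^k}·R_□(x,y)² ≤ C₀·L^{−kD}` — from the zero-field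
box Green's function (§6) through the resolvent identity (§4), the free Agmon bound (§2) and the tilted block-average bound (§3). This is the
`ℓ² → ℓ^∞` smoothing input of the sup-norm decay of the cube propagators `G_k(□,u)` at non-flat backgrounds (sibling file
`BIJ88NeumannPropagatorSmallFieldSupDecay`). [cite: BalabanImbrieJaffe1988, (2.30) p.263] -/
theorem tilted_row_boxR_sq_le (d ℓ : ℕ) (hd3 : d + 1 ≤ 3) (hℓ : 1 ≤ ℓ) {a : ℝ} (ha : 0 < a) :
    ∃ t₀ C₀ : ℝ, 0 < t₀ ∧ 0 < C₀ ∧ ∀ k : ℕ, 1 ≤ k → ∀ (M : Fin (d + 1) → ℕ), (∀ i, 1 ≤ M i) →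
      ∀ t : ℝ, 0 ≤ t → t ≤ t₀ → ∀ x : ↥(boxDom (Nf ℓ k M)),
        ∑ y : ↥(boxDom (Nf ℓ k M)), (Real.exp (t * supNorm (x.1 - y.1) / ((ℓ : ℝ) + 1) ^ k) *
            (boxOpR ((ℓ + 1) ^ k) 0 1 M)⁻¹ x y) ^ 2 ≤ C₀ / (((ℓ : ℝ) + 1) ^ k) ^ (d + 1) := by
  obtain ⟨t₁, C₁, ht₁, hC₁, hG⟩ := tilted_row_boxG_sq_le d ℓ hd3 hℓ ha
  refine ⟨min t₁ (1 / (2 * (d + 1))), (18 + 16 * a ^ 2 * Real.exp 1) * C₁, lt_min ht₁ (by positivity), by positivity, ?_⟩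
  intro k hk1 M hM t ht0 ht1 x
  have hG1 := hG k hk1 M hM t ht0 (ht1.trans (min_le_left _ _)) x
  set L : ℝ := (ℓ : ℝ) + 1 with hLdef
  have hℓ1 : (1 : ℝ) ≤ ℓ := by exact_mod_cast hℓ
  have hL1 : 1 < L := by rw [hLdef]; linarith
  have hLpos : 0 < L := by linarith
  have hn1 : 1 ≤ (ℓ + 1) ^ k := Nat.one_le_pow _ _ (by omega)
  have hncast : (((ℓ + 1) ^ k : ℕ) : ℝ) = L ^ k := by rw [hLdef]; push_cast; rfl
  have hLk : 0 < L ^ k := pow_pos hLpos k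
  have hLk1 : 1 ≤ L ^ k := one_le_pow₀ hL1.le
  have htd : t ≤ 1 / (2 * (d + 1)) := ht1.trans (min_le_right _ _)
  have hD1 : (1 : ℝ) ≤ (d + 1 : ℕ) := by exact_mod_cast Nat.succ_pos d
  have ht12 : t ≤ 1 / 2 := htd.trans (by rw [div_le_div_iff₀ (by positivity) (by norm_num)]; nlinarith)
  -- the objects
  set aS : ℝ := B1.aSeq a L k with haS
  have haS0 : 0 < aS := B1.aSeq_pos ha hL1 hk1
  have haSle : aS ≤ a := B1.aSeq_le ha hL1 k hk1
  set w : ↥(boxDom (Nf ℓ k M)) → ℝ := fun z => Real.exp (t * supNorm (x.1 - z.1) / L ^ k) with hw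
  have hwpos : ∀ z, 0 < w z := fun z => Real.exp_pos _
  set u : ↥(boxDom (Nf ℓ k M)) → ℝ := (boxOpR ((ℓ + 1) ^ k) aS 0 M)⁻¹ *ᵥ Pi.single x (1 : ℝ) with hu
  have hu_apply : ∀ z, u z = (boxOpR ((ℓ + 1) ^ k) aS 0 M)⁻¹ z x := fun z => by
    rw [hu, mulVec_single, MulOpposite.op_one, one_smul, Matrix.col_apply]
  set v : ↥(boxDom (Nf ℓ k M)) → ℝ := (boxOpR ((ℓ + 1) ^ k) aS 0 M - boxOpR ((ℓ + 1) ^ k) 0 1 M) *ᵥ u with hv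
  -- (iii, first) the free Agmon bound for `R v`, with one unit of mass, stated before anything is abbreviated
  set S₁ : ℝ := (t / L ^ k) ^ 2 * Real.exp (t / L ^ k) with hS₁
  have hS₁nn : 0 ≤ S₁ := by positivity
  -- `D·t²·e^{t/L^k} ≤ 1/2`
  have hsmallt : ((d : ℝ) + 1) * t ^ 2 * Real.exp (t / L ^ k) ≤ 1 / 2 := by
    have h1 : Real.exp (t / L ^ k) ≤ Real.exp (1 / 2) := Real.exp_le_exp.2 ((div_le_self ht0 hLk1).trans ht12)
    have h2 : Real.exp (1 / 2 : ℝ) ≤ 2 := by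
      have h1 := Real.exp_one_lt_d9
      have hsq : Real.exp (1 / 2 : ℝ) * Real.exp (1 / 2) = Real.exp 1 := by rw [← Real.exp_add]; norm_num
      nlinarith [Real.exp_pos (1 / 2 : ℝ)]
    have h3 : ((d : ℝ) + 1) * t ^ 2 ≤ 1 / 4 := by
      have hdpos : (0 : ℝ) < (d : ℝ) + 1 := by positivity
      have h4 : t * (2 * ((d : ℝ) + 1)) ≤ 1 := by
        have h5 := htd; rw [le_div_iff₀ (by positivity)] at h5; exact_mod_cast h5
      nlinarith [sq_nonneg t, mul_pos hdpos hdpos]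
    calc ((d : ℝ) + 1) * t ^ 2 * Real.exp (t / L ^ k) ≤ (1 / 4) * 2 := by
          gcongr
          exact h1.trans h2
      _ = 1 / 2 := by norm_num
  have hκ_eq : ((d : ℝ) + 1) * (L ^ k) ^ 2 * S₁ = ((d : ℝ) + 1) * t ^ 2 * Real.exp (t / L ^ k) := by
    rw [hS₁]; field_simp
  have hκ_le : ((d : ℝ) + 1) * (L ^ k) ^ 2 * S₁ ≤ 1 / 2 := by rw [hκ_eq]; exact hsmallt
  have hκ : (d + 1) * ((((ℓ + 1) ^ k : ℕ) : ℝ)) ^ 2 * S₁ < 1 := by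
    rw [hncast]; linarith
  have hwosc : ∀ z : ↥(boxDom (Nf ℓ k M)), ∀ y ∈ boxNbrs (Nf ℓ k M) z, (w z - w y) ^ 2 ≤ S₁ * (w z * w y) :=
    fun z y hy => boxWeight_bond_osc (N := Nf ℓ k M) ht0 hLk x hy
  have hAg : ∑ z, (w z * ((boxOpR ((ℓ + 1) ^ k) 0 1 M)⁻¹ *ᵥ v) z) ^ 2 ≤
      (∑ z, (w z * v z) ^ 2) / (1 - (d + 1) * (L ^ k) ^ 2 * S₁) ^ 2 := by
    have h := agmon_free_box (n := (ℓ + 1) ^ k) (M := M) hn1 hM one_pos hS₁nn hwpos hwosc hκ v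
    rw [hncast] at h
    exact h
  -- the resolvent identity applied to `δ_x`
  have hRe : (boxOpR ((ℓ + 1) ^ k) 0 1 M)⁻¹ *ᵥ Pi.single x (1 : ℝ) = u + (boxOpR ((ℓ + 1) ^ k) 0 1 M)⁻¹ *ᵥ v := by
    conv_lhs => rw [resolvent_identity_box (n := (ℓ + 1) ^ k) (M := M) hn1 hM haS0 one_pos]
    rw [add_mulVec, hv, hu, mulVec_mulVec, mulVec_mulVec]
  -- the weighted norm of `u` (§6)
  set Wu : ℝ := ∑ z, (w z * u z) ^ 2 with hWu
  have hWu_le : Wu ≤ C₁ / (L ^ k) ^ (d + 1) := by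
    rw [hWu]; simp_rw [hu_apply]; exact hG1
  have hWu_nn : 0 ≤ Wu := sum_nonneg fun z _ => sq_nonneg _
  -- (i) the block term: `W(n^{−D}J u) ≤ e^{2t}W(u)`
  have hblk : ∀ z y : ↥(boxDom (Nf ℓ k M)), y ∈ boxBlk ((ℓ + 1) ^ k) (Nf ℓ k M) z → w z ≤ Real.exp t * w y := by
    intro z y hy
    have h := boxWeight_block_osc (n := (ℓ + 1) ^ k) (M := M) hn1 ht0 x z y hy
    rw [hncast] at h
    exact h
  set J : ↥(boxDom (Nf ℓ k M)) → ℝ := fun z => ((L ^ k) ^ (d + 1))⁻¹ * ∑ y ∈ boxBlk ((ℓ + 1) ^ k) (Nf ℓ k M) z, u y with hJ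
  have hJJ : ∑ z, (w z * J z) ^ 2 ≤ Real.exp (2 * t) * Wu := by
    have h := tilted_sq_blockAvg_le (n := (ℓ + 1) ^ k) (M := M) hn1 hwpos hblk u
    rw [hncast] at h
    exact h
  -- (ii) `W(v) ≤ (2a_k²e^{2t} + 2)W(u)`
  have hv_apply : ∀ z, v z = aS * J z - u z := by
    intro z
    rw [hv, boxK_mulVec, hncast, hJ]
    ring
  have hWv : ∑ z, (w z * v z) ^ 2 ≤ (2 * aS ^ 2 * Real.exp (2 * t) + 2) * Wu := by
    have hpt : ∀ z, (w z * v z) ^ 2 ≤ 2 * aS ^ 2 * (w z * J z) ^ 2 + 2 * (w z * u z) ^ 2 := by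
      intro z
      rw [hv_apply z, show w z * (aS * J z - u z) = aS * (w z * J z) + -(w z * u z) by ring]
      refine (add_sq_le_two _ _).trans (le_of_eq ?_); ring
    calc ∑ z, (w z * v z) ^ 2 ≤ ∑ z, (2 * aS ^ 2 * (w z * J z) ^ 2 + 2 * (w z * u z) ^ 2) := sum_le_sum fun z _ => hpt z
      _ = 2 * aS ^ 2 * ∑ z, (w z * J z) ^ 2 + 2 * Wu := by rw [sum_add_distrib, ← mul_sum, ← mul_sum]
      _ ≤ 2 * aS ^ 2 * (Real.exp (2 * t) * Wu) + 2 * Wu := by gcongr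
      _ = (2 * aS ^ 2 * Real.exp (2 * t) + 2) * Wu := by ring
  -- (iii) the free Agmon bound gives `W(Rv) ≤ 4·W(v)`
  set κ : ℝ := ((d : ℝ) + 1) * (L ^ k) ^ 2 * S₁ with hκdef
  have hden : 4 * (1 - κ) ^ 2 ≥ 1 := by
    have h1 : 1 / 2 ≤ 1 - κ := by linarith
    nlinarith
  have hRv : ∑ z, (w z * ((boxOpR ((ℓ + 1) ^ k) 0 1 M)⁻¹ *ᵥ v) z) ^ 2 ≤ 4 * ((2 * aS ^ 2 * Real.exp (2 * t) + 2) * Wu) := by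
    refine hAg.trans ?_
    have hpos : 0 < (1 - κ) ^ 2 := by
      have : 0 < 1 - κ := by linarith
      positivity
    rw [div_le_iff₀ hpos]
    have hnum_nn : 0 ≤ (2 * aS ^ 2 * Real.exp (2 * t) + 2) * Wu := by positivity
    calc ∑ z, (w z * v z) ^ 2 ≤ (2 * aS ^ 2 * Real.exp (2 * t) + 2) * Wu := hWv
      _ = (2 * aS ^ 2 * Real.exp (2 * t) + 2) * Wu * 1 := (mul_one _).symm
      _ ≤ (2 * aS ^ 2 * Real.exp (2 * t) + 2) * Wu * (4 * (1 - κ) ^ 2) := mul_le_mul_of_nonneg_left hden hnum_nn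
      _ = 4 * ((2 * aS ^ 2 * Real.exp (2 * t) + 2) * Wu) * (1 - κ) ^ 2 := by ring
  -- (iv) assemble
  have hsum : ∑ y, (w y * (boxOpR ((ℓ + 1) ^ k) 0 1 M)⁻¹ x y) ^ 2 ≤
      2 * Wu + 2 * ∑ z, (w z * ((boxOpR ((ℓ + 1) ^ k) 0 1 M)⁻¹ *ᵥ v) z) ^ 2 := by
    calc ∑ y, (w y * (boxOpR ((ℓ + 1) ^ k) 0 1 M)⁻¹ x y) ^ 2
        = ∑ y, (w y * u y + w y * ((boxOpR ((ℓ + 1) ^ k) 0 1 M)⁻¹ *ᵥ v) y) ^ 2 := by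
          refine sum_congr rfl fun y _ => ?_
          rw [boxInv_apply_eq_mulVec_single, hRe, Pi.add_apply, mul_add]
      _ ≤ ∑ y, (2 * (w y * u y) ^ 2 + 2 * (w y * ((boxOpR ((ℓ + 1) ^ k) 0 1 M)⁻¹ *ᵥ v) y) ^ 2) :=
          sum_le_sum fun y _ => add_sq_le_two _ _
      _ = 2 * Wu + 2 * ∑ z, (w z * ((boxOpR ((ℓ + 1) ^ k) 0 1 M)⁻¹ *ᵥ v) z) ^ 2 := by
          rw [sum_add_distrib, ← mul_sum, ← mul_sum]
  have he2t : Real.exp (2 * t) ≤ Real.exp 1 := Real.exp_le_exp.2 (by linarith)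
  have hα2 : aS ^ 2 ≤ a ^ 2 := pow_le_pow_left₀ haS0.le haSle 2
  have hcoef : 2 + 8 * (2 * aS ^ 2 * Real.exp (2 * t) + 2) ≤ 18 + 16 * a ^ 2 * Real.exp 1 := by
    have h3 : aS ^ 2 * Real.exp (2 * t) ≤ a ^ 2 * Real.exp 1 := mul_le_mul hα2 he2t (Real.exp_pos _).le (sq_nonneg _)
    linarith
  calc ∑ y, (w y * (boxOpR ((ℓ + 1) ^ k) 0 1 M)⁻¹ x y) ^ 2
      ≤ 2 * Wu + 2 * ∑ z, (w z * ((boxOpR ((ℓ + 1) ^ k) 0 1 M)⁻¹ *ᵥ v) z) ^ 2 := hsum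
    _ ≤ 2 * Wu + 2 * (4 * ((2 * aS ^ 2 * Real.exp (2 * t) + 2) * Wu)) := by gcongr
    _ = (2 + 8 * (2 * aS ^ 2 * Real.exp (2 * t) + 2)) * Wu := by ring
    _ ≤ (18 + 16 * a ^ 2 * Real.exp 1) * Wu := mul_le_mul_of_nonneg_right hcoef hWu_nn
    _ ≤ (18 + 16 * a ^ 2 * Real.exp 1) * (C₁ / (L ^ k) ^ (d + 1)) := mul_le_mul_of_nonneg_left hWu_le (by positivity)
    _ = (18 + 16 * a ^ 2 * Real.exp 1) * C₁ / (L ^ k) ^ (d + 1) := by ring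

end TiltedRowR

end

end Literature.MathematicalPhysics.QuantumFieldTheory.BalabanImbrieJaffe1984to88.BIJ88FreeNeumannResolventBox
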